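import Literature.MathematicalPhysics.QuantumLattice.FrozenEnvironmentEmbedding
import Literature.MathematicalPhysics.QuantumChemistry.PositivityConditions
import HarnessLib

/-!
# Slicing a Fock-space vector along an order embedding of spin orbitals: the subsystem
# decomposition of expectation values and reduced density matrices

Topic `Literature/MathematicalPhysics/QuantumChemistry`; the STATE-SLICING companion of
`QuantumLattice/FrozenEnvironmentEmbedding.lean` (the frozen-environment isometries
`V_K = frozenEmbed e K : 𝔉(ι) → 𝔉(ι')` along an order embedding `e : ι ↪o ι'` of finite linearly ordered
spin-orbital sets, one for every configuration `K` of the ENVIRONMENT orbitals `ι' ∖ e ι`) and the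
Fock-space bookkeeping behind the SUBSYSTEM CONSTRAINTS of Verstichel–van Aggelen–Van Neck–Ayers–Bultinck
(2010) (`SubsystemConstraints.lean`). Expanding a vector `Ψ` of the big Fock space "in Slater determinants,
classified according to the number of subsystem orbitals they contain",
`|Ψ⟩ = Σ_{j, s_j, s̄} C_{s_j s̄} |s_j s̄⟩`, the paper attaches to every environment string `s̄` the
(unnormalised) subsystem vector `|Ψ_{s̄}⟩ = Σ_{s_j} C_{s_j s̄} |s_j⟩` (Verstichel et al. (2010) §2.3,
eqs. (16)–(19)); in the tree's language this SLICE is `V_Kᴴ Ψ` with `K = s̄` (up to the Jordan–Wigner sign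
`transSign e K` carried by `V_K`, `conjTranspose_frozenEmbed_mulVec_apply`). This file PROVES:

* `sum_frozenEmbed_mul_conjTranspose`: **completeness of the slices**, `Σ_K V_K V_Kᴴ = 1` (the Fock space
  of `ι'` is the orthogonal direct sum of the frozen blocks, Bratteli–Robinson II §5.2.1: `𝔉(𝔥₁ ⊕ 𝔥₂)`);
* `jwEmbed_eq_sum_conj`: every embedded subsystem observable is block diagonal,
  `jwEmbed e a = Σ_K V_K a V_Kᴴ`, hence **expectation values decompose over the slices**,
  `⟨Ψ| jwEmbed e a |Ψ⟩ = Σ_K ⟨V_Kᴴ Ψ| a |V_Kᴴ Ψ⟩` (`star_dotProduct_jwEmbed_mulVec`; the paper's eq. (17):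
  "the string of subsystem-type creation/annihilation operators … does not change the number of subsystem
  orbitals, … leaves the non-subsystem part of the Slater determinant unchanged, and using orthonormality of
  the `s̄` states"), in particular `⟨Ψ,Ψ⟩ = Σ_K ⟨V_Kᴴ Ψ, V_Kᴴ Ψ⟩` (eq. (19)/(22): the squared norms
  `w_{s̄}` of the slices sum to `⟨Ψ,Ψ⟩`);
* **particle number of a slice**: if `Ψ` has `N` particles, the slice `V_Kᴴ Ψ` has `N − |K|` particles
  (`isNParticle_conjTranspose_frozenEmbed_mulVec`; it vanishes when `|K| > N` or when `K` meets the image);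
* **restriction of the reduced density matrices** (`oneRDM`, `twoRDM` of `PositivityConditions.lean`): the
  subsystem blocks of `¹D(Ψ)`, `²D(Ψ)` are the sums of the RDMs of the slices,
  `¹D(Ψ)_{e i, e k} = Σ_K ¹D(V_Kᴴ Ψ)_{ik}`, `²D(Ψ)_{(e i, e j),(e k, e l)} = Σ_K ²D(V_Kᴴ Ψ)_{(i,j),(k,l)}`
  (`oneRDM_submatrix_eq_sum`, `twoRDM_submatrix_eq_sum`; Verstichel et al. (2010) eqs. (17), (21), (23)).

Everything is PROVED (0 sorry) from `frozenEmbed_apply`, `jwEmbed_mul_frozenEmbed` and the configuration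
calculus `JWEmbed.pre/env/combine` of `FermionEmbedding.lean`; no definition is introduced (the slice is
written `(frozenEmbed e K)ᴴ *ᵥ Ψ` throughout). NOT here: the regrouping of the slices into a
fractional-particle-number ensemble and the energy inequalities (that is `SubsystemConstraints.lean`);
spin (`S_z`) sectors of the slices. Tree search (`lean search 'frozenEmbed|conjTranspose_frozenEmbed|slice'`):
only the EMBEDDING direction existed (`FrozenEnvironmentEmbedding`, `FrozenCoreDensityMatrices`: RDMs of
`V_K ψ`), not the slicing direction `V_Kᴴ Ψ`.

## References
* B. Verstichel, H. van Aggelen, D. Van Neck, P. W. Ayers, P. Bultinck, *Subsystem constraints in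
  variational second order density matrix optimization: curing the dissociative behavior*, J. Chem. Phys.
  132 (2010) 114113, arXiv:0910.4094, §2.3 eqs. (15)–(23). [VerstichelEtAl2010Subsystem]
* B. Verstichel, PhD thesis, Ghent University (2012), arXiv:1203.5659, Ch. 2 §3.1.2 (same construction).
  [Verstichel2012Thesis]
* O. Bratteli, D. W. Robinson, *Operator Algebras and Quantum Statistical Mechanics II* (1997), §5.2.1–5.2.2
  (Fock space of a direct sum; the Fock representation restricted to `𝔄(𝔥₁)`). [BratteliRobinsonII1997]
-/

noncomputable section

namespace Literature.MathematicalPhysics.QuantumChemistry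

open Matrix Finset Literature.MathematicalPhysics.QuantumLattice JWEmbed
open scoped symmDiff

variable {ι ι' : Type*} [LinearOrder ι] [LinearOrder ι'] [Fintype ι] [Fintype ι']
variable (e : ι ↪o ι')

/-! ### The slices `V_Kᴴ Ψ` -/

omit [Fintype ι'] in
/-- If `K` meets the image of `e` then no configuration has environment `K` and `V_K = 0`.
[cite: BratteliRobinsonII1997, §5.2.1 (Fock space 𝔉(𝔥₁ ⊕ 𝔥₂); occupation-number basis)] -/
theorem frozenEmbed_eq_zero_of_not_disjoint {K : Finset ι'} (hK : ¬ Disjoint K (rangeF e)) :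
    frozenEmbed e K = 0 := by
  ext u' u
  rw [frozenEmbed_apply, if_neg, Matrix.zero_apply]
  rintro ⟨h, -⟩
  exact hK (h ▸ disjoint_env_rangeF u')

/-- **The slice of `Ψ` at the environment configuration `K`**: `(V_Kᴴ Ψ)(u) = transSign e K u · Ψ(e u ∪ K)`
— the coefficient vector `C_{s_j s̄}` of the paper's `|Ψ_{s̄}⟩ = Σ_{s_j} C_{s_j s̄} |s_j⟩` (`s̄ = K`), with the
Jordan–Wigner sign of the embedding. [cite: VerstichelEtAl2010Subsystem, §2.3 eqs. (16), (18)] -/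
theorem conjTranspose_frozenEmbed_mulVec_apply {K : Finset ι'} (hK : Disjoint K (rangeF e))
    (Ψ : Fock ι') (u : Finset ι) :
    ((frozenEmbed e K)ᴴ *ᵥ Ψ) u = transSign e K u * Ψ (combine e u K) := by
  rw [mulVec, dotProduct, Finset.sum_eq_single (combine e u K)]
  · rw [conjTranspose_apply, frozenEmbed_combine e hK, star_transSign]
  · intro u' _ hu'
    rw [conjTranspose_apply]
    by_cases h0 : frozenEmbed e K u' u = 0
    · rw [h0, star_zero, zero_mul]
    · exact absurd (eq_combine_of_frozenEmbed_ne_zero e K h0) hu'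
  · intro h
    exact absurd (Finset.mem_univ _) h

/-- **Completeness of the slices**: `Σ_K V_K V_Kᴴ = 1` — the big Fock space is the orthogonal direct sum of
the frozen blocks `V_K 𝔉(ι)` over all environment configurations `K` (terms with `K` meeting the image
vanish). [cite: BratteliRobinsonII1997, §5.2.1 (Fock space 𝔉(𝔥₁ ⊕ 𝔥₂); occupation-number basis)] -/
theorem sum_frozenEmbed_mul_conjTranspose :
    ∑ K : Finset ι', frozenEmbed e K * (frozenEmbed e K)ᴴ = 1 := by
  ext u' v'
  rw [Matrix.sum_apply, Finset.sum_eq_single (env e u')]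
  · rw [Matrix.mul_apply, Finset.sum_eq_single (pre e u')]
    · rw [conjTranspose_apply, frozenEmbed_apply, if_pos ⟨rfl, rfl⟩, frozenEmbed_apply, Matrix.one_apply]
      by_cases h : u' = v'
      · subst h
        rw [if_pos ⟨rfl, rfl⟩, star_transSign, transSign_mul_transSign, symmDiff_self,
          Finset.bot_eq_empty, transSign_empty, if_pos rfl]
      · rw [if_neg, star_zero, mul_zero, if_neg h]
        rintro ⟨h1, h2⟩
        exact h ((eq_iff_pre_eq_and_env_eq (e := e)).2 ⟨h2.symm, h1.symm⟩)
    · intro u _ hu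
      rw [frozenEmbed_apply, if_neg (fun h' => hu h'.2.symm), zero_mul]
    · intro h
      exact absurd (Finset.mem_univ _) h
  · intro K _ hK
    rw [Matrix.mul_apply]
    exact Finset.sum_eq_zero fun u _ => by
      rw [frozenEmbed_apply_of_env_ne e K (Ne.symm hK), zero_mul]
  · intro h
    exact absurd (Finset.mem_univ _) h

/-- A vector of the big Fock space is the sum of its embedded slices: `Ψ = Σ_K V_K (V_Kᴴ Ψ)` (the
expansion "in Slater determinants, classified according to the number of subsystem orbitals they
contain"). [cite: VerstichelEtAl2010Subsystem, §2.3 eq. (16)] -/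
theorem sum_frozenEmbed_mulVec_conjTranspose_mulVec (Ψ : Fock ι') :
    ∑ K : Finset ι', frozenEmbed e K *ᵥ ((frozenEmbed e K)ᴴ *ᵥ Ψ) = Ψ := by
  conv_rhs => rw [← one_mulVec Ψ, ← sum_frozenEmbed_mul_conjTranspose e, Matrix.sum_mulVec]
  exact Finset.sum_congr rfl fun K _ => mulVec_mulVec _ _ _

/-! ### Embedded observables are block diagonal; expectation values decompose -/

/-- **An embedded subsystem observable is block diagonal in the slices**: `jwEmbed e a = Σ_K V_K a V_Kᴴ`
(on each frozen block the second quantisation of `e` acts as `a`, `jwEmbed_mul_frozenEmbed`).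
[cite: BratteliRobinsonII1997, §5.2.2, Thm. 5.2.5 (the Fock representation restricted to 𝔄(𝔥₁))] -/
theorem jwEmbed_eq_sum_conj (a : Matrix (Finset ι) (Finset ι) ℂ) :
    jwEmbed e a = ∑ K : Finset ι', frozenEmbed e K * a * (frozenEmbed e K)ᴴ := by
  calc jwEmbed e a = jwEmbed e a * ∑ K : Finset ι', frozenEmbed e K * (frozenEmbed e K)ᴴ := by
        rw [sum_frozenEmbed_mul_conjTranspose, Matrix.mul_one]
    _ = ∑ K : Finset ι', jwEmbed e a * frozenEmbed e K * (frozenEmbed e K)ᴴ := by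
        rw [Finset.mul_sum]
        exact Finset.sum_congr rfl fun K _ => (Matrix.mul_assoc _ _ _).symm
    _ = ∑ K : Finset ι', frozenEmbed e K * a * (frozenEmbed e K)ᴴ :=
        Finset.sum_congr rfl fun K _ => by
          by_cases hK : Disjoint K (rangeF e)
          · rw [jwEmbed_mul_frozenEmbed e hK]
          · rw [frozenEmbed_eq_zero_of_not_disjoint e hK, Matrix.mul_zero, Matrix.zero_mul,
              conjTranspose_zero, Matrix.mul_zero]

/-- **Expectation values of subsystem observables decompose over the slices**:
`⟨Ψ| jwEmbed e a |Ψ⟩ = Σ_K ⟨V_Kᴴ Ψ| a |V_Kᴴ Ψ⟩` ("the string of subsystem-type creation/annihilation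
operators … does not change the number of subsystem orbitals, … leaves the non-subsystem part of the Slater
determinant unchanged, and using orthonormality of the `s̄` states").
[cite: VerstichelEtAl2010Subsystem, §2.3 eq. (17)] -/
theorem star_dotProduct_jwEmbed_mulVec (a : Matrix (Finset ι) (Finset ι) ℂ) (Ψ : Fock ι') :
    star Ψ ⬝ᵥ jwEmbed e a *ᵥ Ψ =
      ∑ K : Finset ι', star ((frozenEmbed e K)ᴴ *ᵥ Ψ) ⬝ᵥ a *ᵥ ((frozenEmbed e K)ᴴ *ᵥ Ψ) := by
  rw [jwEmbed_eq_sum_conj, Matrix.sum_mulVec, dotProduct_sum]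
  refine Finset.sum_congr rfl fun K _ => ?_
  rw [← mulVec_mulVec, ← mulVec_mulVec, dotProduct_mulVec, star_mulVec, conjTranspose_conjTranspose]

/-- **The squared norms of the slices sum to the squared norm**: `⟨Ψ,Ψ⟩ = Σ_K ⟨V_Kᴴ Ψ, V_Kᴴ Ψ⟩` (the
weights `w_{s̄} = Σ_{s_j} |C_{s_j s̄}|²` of the slices; for a unit vector they sum to one).
[cite: VerstichelEtAl2010Subsystem, §2.3 eqs. (19), (22)] -/
theorem star_dotProduct_self_eq_sum (Ψ : Fock ι') :
    star Ψ ⬝ᵥ Ψ = ∑ K : Finset ι', star ((frozenEmbed e K)ᴴ *ᵥ Ψ) ⬝ᵥ ((frozenEmbed e K)ᴴ *ᵥ Ψ) := by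
  have h := star_dotProduct_jwEmbed_mulVec e 1 Ψ
  simp only [map_one, one_mulVec] at h
  exact h

/-! ### Particle number of the slices -/

/-- A non-zero coefficient of the slice at `K` sits on a configuration `u` with `|u| + |K| = N` when `Ψ`
is an `N`-particle vector (`|e u ∪ K| = |u| + |K|`). [cite: VerstichelEtAl2010Subsystem, §2.3 eq. (16)] -/
theorem card_add_card_eq_of_conjTranspose_frozenEmbed_mulVec_ne_zero {N : ℕ} {Ψ : Fock ι'}
    (hΨ : IsNParticle N Ψ) {K : Finset ι'} {u : Finset ι} (h : ((frozenEmbed e K)ᴴ *ᵥ Ψ) u ≠ 0) :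
    u.card + K.card = N := by
  by_cases hK : Disjoint K (rangeF e)
  · rw [conjTranspose_frozenEmbed_mulVec_apply e hK] at h
    have hΨ' : Ψ (combine e u K) ≠ 0 := fun h0 => h (by rw [h0, mul_zero])
    by_contra hne
    exact hΨ' (hΨ _ (by rw [card_combine e hK]; exact hne))
  · rw [frozenEmbed_eq_zero_of_not_disjoint e hK, conjTranspose_zero, zero_mulVec] at h
    exact absurd rfl h

/-- **The slice at `K` of an `N`-particle vector is an `(N − |K|)`-particle vector** of the subsystem
Fock space ("a state with `j` particles in the Fock space generated by the subsystem orbitals",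
`j + |s̄| = N`). [cite: VerstichelEtAl2010Subsystem, §2.3 eq. (18)] -/
theorem isNParticle_conjTranspose_frozenEmbed_mulVec {N : ℕ} {Ψ : Fock ι'} (hΨ : IsNParticle N Ψ)
    (K : Finset ι') {M : ℕ} (hM : M + K.card = N) :
    IsNParticle M ((frozenEmbed e K)ᴴ *ᵥ Ψ) := by
  intro u hu
  by_contra h
  have h' := card_add_card_eq_of_conjTranspose_frozenEmbed_mulVec_ne_zero e hΨ h
  omega

/-- Slices at environment configurations with more than `N` orbitals vanish.
[cite: VerstichelEtAl2010Subsystem, §2.3 eq. (16) (0 ≤ j ≤ N)] -/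
theorem conjTranspose_frozenEmbed_mulVec_eq_zero_of_lt {N : ℕ} {Ψ : Fock ι'} (hΨ : IsNParticle N Ψ)
    {K : Finset ι'} (hK : N < K.card) : (frozenEmbed e K)ᴴ *ᵥ Ψ = 0 := by
  ext u
  by_contra h
  have h' := card_add_card_eq_of_conjTranspose_frozenEmbed_mulVec_ne_zero e hΨ h
  omega

/-! ### Restriction of the reduced density matrices to the subsystem -/

/-- **Subsystem block of the one-matrix**: `¹D(Ψ)_{e i, e k} = Σ_K ¹D(V_Kᴴ Ψ)_{ik}`.
[cite: VerstichelEtAl2010Subsystem, §2.3 eq. (23)] -/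
theorem oneRDM_apply_eq_sum (Ψ : Fock ι') (i k : ι) :
    oneRDM Ψ (e i) (e k) = ∑ K : Finset ι', oneRDM ((frozenEmbed e K)ᴴ *ᵥ Ψ) i k := by
  simp only [oneRDM]
  rw [← jwEmbed_creation e, ← jwEmbed_annihilation e, ← map_mul, star_dotProduct_jwEmbed_mulVec]

/-- Matrix form: the restriction `¹D(Ψ)|_{e ι}` (the submatrix along `e`) is the sum of the one-matrices
of the slices. [cite: VerstichelEtAl2010Subsystem, §2.3 eq. (23)] -/
theorem oneRDM_submatrix_eq_sum (Ψ : Fock ι') :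
    (oneRDM Ψ).submatrix e e = ∑ K : Finset ι', oneRDM ((frozenEmbed e K)ᴴ *ᵥ Ψ) := by
  ext i k
  rw [submatrix_apply, Matrix.sum_apply, oneRDM_apply_eq_sum]

/-- **Subsystem block of the two-matrix**: `²D(Ψ)_{(e i, e j),(e k, e l)} = Σ_K ²D(V_Kᴴ Ψ)_{(i,j),(k,l)}`
("`Γ^sub_{ab;cd} = Σ … ⟨Ψ_{s̄}| a†_a a†_b a_d a_c |Ψ_{s̄}⟩`").
[cite: VerstichelEtAl2010Subsystem, §2.3 eqs. (17), (21)] -/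
theorem twoRDM_apply_eq_sum (Ψ : Fock ι') (i j k l : ι) :
    twoRDM Ψ (e i, e j) (e k, e l) =
      ∑ K : Finset ι', twoRDM ((frozenEmbed e K)ᴴ *ᵥ Ψ) (i, j) (k, l) := by
  simp only [twoRDM]
  rw [← jwEmbed_creation e, ← jwEmbed_creation e, ← jwEmbed_annihilation e, ← jwEmbed_annihilation e,
    ← map_mul, ← map_mul, ← map_mul, star_dotProduct_jwEmbed_mulVec]

/-- Matrix form: the restriction `²D(Ψ)|_{e ι}` (the submatrix along `e × e`) is the sum of the
two-matrices of the slices. [cite: VerstichelEtAl2010Subsystem, §2.3 eq. (21)] -/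
theorem twoRDM_submatrix_eq_sum (Ψ : Fock ι') :
    (twoRDM Ψ).submatrix (Prod.map e e) (Prod.map e e) =
      ∑ K : Finset ι', twoRDM ((frozenEmbed e K)ᴴ *ᵥ Ψ) := by
  ext p q
  obtain ⟨i, j⟩ := p
  obtain ⟨k, l⟩ := q
  rw [submatrix_apply, Matrix.sum_apply, Prod.map_apply, Prod.map_apply, twoRDM_apply_eq_sum]

end Literature.MathematicalPhysics.QuantumChemistry

end
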